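import Mathlib.Analysis.SpecialFunctions.Integrability.Basic
import Summits.CriticalPhenomena.SAWScalingLimit.Theorems.SAWDefectDecoherenceBoundaryClosureRPolygonLocalFrame
import HarnessLib

/-!
# Green on shifted half-balls: `∫_P g ∂̄(ℓχ) dA = 0` on a flat boundary ball
(crux `BoundaryClosureR`, stmt-CriticalPhenomena-14004, line `polygon-parity-squeeze`, sub-goal of the
registered stub `polygonLocalIdentity`, step (c); registered helper
`setIntegral_mul_dbarAlong_levelMul_eq_zero`)

On a ball `B(z, s)` in which the open set `P` is the half-plane `{ℓ > 0}`, `ℓ(w) = Re((w - z)·conj n)`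
(`‖n‖ = 1`), a function `g` holomorphic on `P` and integrable on `P ∩ B̄(z, s/2)` pairs to zero with
`∂̄(ℓχ)` for every smooth `χ` supported in `B(z, s/2)`:

  `∫_P g · ∂̄(ℓ χ) dA = 0`.

Proof.  Green's formula on the shifted half-plane `{ℓ > t}` (`green_levelLine`; `g` is holomorphic up
to the line `{ℓ = t}` for `t > 0`) gives `∫_{ℓ > t} g ∂̄(ℓχ) = -(n/2)·t·∫ χ g dx` along `{ℓ = t}`, of
modulus `≤ (t/2)‖χ‖_∞ m(t)` with `m(t) = ∫_{ℓ = t, B(z,s/2)} |g| dx` integrable in `t` (Fubini in the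
frame); hence along suitable levels `t_j ↓ 0` the left side tends to `0`
(`exists_small_of_integrable_majorant`: `1/t` is not integrable at `0⁺`), while it tends to
`∫_{ℓ > 0} g ∂̄(ℓχ)` by dominated convergence.
References: folklore (Green's formula, Fubini, dominated convergence).  No definition is introduced.
-/

noncomputable section

open scoped Topology ComplexConjugate ContDiff
open Filter Set Metric MeasureTheory Complex
open Literature.Analysis.Complex (dbarAlong dbarAlong_one dbarAlong_eq_zero_of_notMem_tsupport
  continuous_dbarAlong_one tsupport_dbarAlong_one_subset hasCompactSupport_dbarAlong_one)

namespace Summit.CriticalPhenomena.SAWScalingLimit.Theorems.PolygonParitySqueeze.PolygonLocal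

/-! ### The pairing of `g` with `∂̄(ℓχ)` vanishes -/

/-- `1/t` is not integrable at `0⁺`. [folklore] -/
theorem not_integrableOn_inv_Ioo {ε : ℝ} (hε : 0 < ε) : ¬ IntegrableOn (fun t : ℝ => t⁻¹) (Ioo 0 ε) := by
  intro h
  have hnot : ¬ IntervalIntegrable (fun t : ℝ => t⁻¹) volume 0 ε := by
    rw [intervalIntegrable_inv_iff]
    push Not
    exact ⟨hε.ne, by simp [hε.le]⟩
  apply hnot
  rw [intervalIntegrable_iff, uIoc_of_le hε.le, integrableOn_Ioc_iff_integrableOn_Ioo]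
  exact h

/-- **Liminf selection.** If `m ≥ 0` is integrable near `0⁺` and `‖I t‖ ≤ t · m t` for a.e. small
`t > 0`, then for every `c > 0` and `ε > 0` some `t ∈ (0, ε)` has `‖I t‖ ≤ c` (otherwise `m ≥ c/t²·t`
would not be integrable). [folklore] -/
theorem exists_small_of_integrable_majorant {I : ℝ → ℂ} {m : ℝ → ℝ} {ε c : ℝ} (hε : 0 < ε) (hc : 0 < c)
    (hm : IntegrableOn m (Ioo 0 ε)) (hIm : ∀ᵐ t ∂(volume.restrict (Ioo 0 ε)), ‖I t‖ ≤ t * m t) :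
    ∃ t : ℝ, 0 < t ∧ t < ε ∧ ‖I t‖ ≤ c := by
  by_contra hcon
  push Not at hcon
  have hae : ∀ᵐ t ∂(volume.restrict (Ioo 0 ε)), ‖c * t⁻¹‖ ≤ m t := by
    rw [ae_restrict_iff' measurableSet_Ioo] at hIm ⊢
    filter_upwards [hIm] with t hIt ht
    have ht0 : 0 < t := ht.1
    have h1 := hcon t ht0 ht.2
    have h2 := hIt ht
    rw [norm_mul, norm_inv, Real.norm_of_nonneg hc.le, Real.norm_of_nonneg ht0.le]
    rw [← div_eq_mul_inv, div_le_iff₀ ht0]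
    nlinarith
  have hCi : IntegrableOn (fun t : ℝ => c * t⁻¹) (Ioo 0 ε) :=
    Integrable.mono' hm (measurable_const.mul measurable_inv).aestronglyMeasurable hae
  have hinv : IntegrableOn (fun t : ℝ => t⁻¹) (Ioo 0 ε) := by
    have h := hCi.const_mul c⁻¹
    refine IntegrableOn.congr_fun h (fun t _ => ?_) measurableSet_Ioo
    show c⁻¹ * (c * t⁻¹) = t⁻¹
    rw [← mul_assoc, inv_mul_cancel₀ hc.ne', one_mul]
  exact not_integrableOn_inv_Ioo hε hinv

/-- **The pairing of `g` with `∂̄(ℓχ)` vanishes on a flat boundary ball.**  `P` open with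
`P ∩ B(z, s) = {ℓ > 0} ∩ B(z, s)`, `g` holomorphic on `P` and integrable on `B̄(z, s/2) ∩ P`, `χ` smooth
with `tsupport χ ⊆ B(z, s/2)`: `∫_P g ∂̄(ℓχ) dA = 0`. [folklore] -/
theorem setIntegral_mul_dbarAlong_levelMul_eq_zero : ∀ (Ω : Set ℂ) (z n : ℂ) (s : ℝ) (g χ : ℂ → ℂ), IsOpen Ω → ‖n‖ = 1 → 0 < s → Ω ∩ Metric.ball z s = {w : ℂ | 0 < ((w - z) * (starRingEnd ℂ) n).re} ∩ Metric.ball z s → DifferentiableOn ℂ g Ω → MeasureTheory.IntegrableOn g (Metric.closedBall z (s / 2) ∩ Ω) → ContDiff ℝ ∞ χ → tsupport χ ⊆ Metric.ball z (s / 2) → ∫ w in Ω, g w * Literature.Analysis.Complex.dbarAlong 1 (fun w => ((((w - z) * (starRingEnd ℂ) n).re : ℝ) : ℂ) * χ w) w = 0 := by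
  intro Ω z n s g χ hΩ hn hs hflat hg hgi hχ hχs
  set ℓ : ℂ → ℝ := fun w => ((w - z) * conj n).re with hℓ
  set ψ : ℂ → ℂ := fun w => ((ℓ w : ℝ) : ℂ) * χ w with hψdef
  set hp : Set ℂ := {w : ℂ | 0 < ℓ w} with hhp
  have hℓc : Continuous ℓ :=
    Complex.continuous_re.comp ((continuous_id.sub continuous_const).mul continuous_const)
  have hhpo : IsOpen hp := isOpen_lt continuous_const hℓc
  ---------------------------------------------------------------- `χ`, `ψ`
  have hχc : HasCompactSupport χ :=
    IsCompact.of_isClosed_subset (isCompact_closedBall z (s / 2)) (isClosed_tsupport χ)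
      (hχs.trans ball_subset_closedBall)
  have hψ : ContDiff ℝ ∞ ψ := (contDiff_level z n).mul hχ
  have hψ1 : ContDiff ℝ 1 ψ := hψ.of_le (by
    change ((1 : ℕ∞) : WithTop ℕ∞) ≤ ((⊤ : ℕ∞) : WithTop ℕ∞); exact WithTop.coe_le_coe.2 le_top)
  have hψsupp : tsupport ψ ⊆ tsupport χ :=
    tsupport_mul_subset_right (f := fun w => ((ℓ w : ℝ) : ℂ)) (g := χ)
  have hψs : tsupport ψ ⊆ ball z (s / 2) := hψsupp.trans hχs
  have hψc : HasCompactSupport ψ := hχc.mono' ((subset_tsupport _).trans hψsupp)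
  obtain ⟨M, hM⟩ := hχ.continuous.norm.bddAbove_range_of_hasCompactSupport hχc.norm
  have hM' : ∀ w, ‖χ w‖ ≤ M := fun w => hM ⟨w, rfl⟩
  have hM0 : 0 ≤ M := (norm_nonneg _).trans (hM' z)
  obtain ⟨B, hB⟩ := (continuous_dbarAlong_one hψ1).norm.bddAbove_range_of_hasCompactSupport
    (hasCompactSupport_dbarAlong_one hψc).norm
  have hB' : ∀ w, ‖dbarAlong 1 ψ w‖ ≤ B := fun w => hB ⟨w, rfl⟩
  ---------------------------------------------------------------- the integrand
  set f : ℂ → ℂ := fun w => g w * dbarAlong 1 ψ w with hfdef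
  have hf0 : ∀ w, w ∉ ball z (s / 2) → f w = 0 := fun w hw => by
    simp only [hfdef]
    rw [dbarAlong_eq_zero_of_notMem_tsupport (fun h => hw (hψs h)), mul_zero]
  have hΩhp : ∀ w ∈ ball z s, w ∈ Ω ↔ w ∈ hp := fun w hw => by
    constructor
    · intro h
      have h' : w ∈ Ω ∩ ball z s := ⟨h, hw⟩
      rw [hflat] at h'
      exact h'.1
    · intro h
      have h' : w ∈ hp ∩ ball z s := ⟨h, hw⟩
      rw [← hflat] at h'
      exact h'.1
  ---------------------------------------------------------------- Step 1: `∫_Ω f = ∫_{ℓ > 0} f`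
  have step1 : ∫ w in Ω, f w = ∫ w in hp, f w := by
    have e1 : ∫ w in Ω, f w = ∫ w in Ω ∩ ball z s, f w :=
      setIntegral_eq_of_subset_of_forall_sdiff_eq_zero hΩ.measurableSet inter_subset_left
        fun w hw => hf0 w fun h => hw.2 ⟨hw.1, ball_subset_ball (by linarith) h⟩
    have e2 : ∫ w in hp, f w = ∫ w in hp ∩ ball z s, f w :=
      setIntegral_eq_of_subset_of_forall_sdiff_eq_zero hhpo.measurableSet inter_subset_left
        fun w hw => hf0 w fun h => hw.2 ⟨hw.1, ball_subset_ball (by linarith) h⟩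
    rw [e1, e2, hflat]
  ---------------------------------------------------------------- Step 2: Green at level `t > 0`
  set c : ℂ := -I * n with hc
  have hcn : ‖c‖ = 1 := by rw [hc, norm_mul, norm_neg, Complex.norm_I, one_mul, hn]
  set A : ℂ → ℂ := fun ζ => z + c * ζ with hA
  have hAlev : ∀ ζ, ℓ (A ζ) = ζ.im := fun ζ => by simp only [hA, hc, hℓ]; exact level_frame hn z ζ
  have hAball : ∀ ζ (r : ℝ), A ζ ∈ ball z r ↔ ζ ∈ ball (0 : ℂ) r := fun ζ r => frame_mem_ball_iff hcn z ζ r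
  have hI : ∀ t : ℝ, 0 < t → ∫ w in {w : ℂ | t < ℓ w}, f w =
      -(n / 2) * t * ∫ x : ℝ, χ (A ((x : ℂ) + (t : ℂ) * I)) * g (A ((x : ℂ) + (t : ℂ) * I)) := by
    intro t ht
    have hg' : DifferentiableOn ℂ g ({w : ℂ | t < ℓ w} ∩ ball z s) :=
      hg.mono fun w hw => (hΩhp w hw.2).2 (lt_trans ht hw.1)
    have hgc' : ContinuousOn g ({w : ℂ | t ≤ ℓ w} ∩ ball z s) :=
      hg.continuousOn.mono fun w hw => (hΩhp w hw.2).2 (lt_of_lt_of_le ht hw.1)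
    have key := setIntegral_dbarAlong_mul_eq_lineIntegral hn hg' hgc' hψ1 hψc
      (hψs.trans (ball_subset_ball (by linarith)))
    have e1 : ∫ w in {w : ℂ | t < ℓ w}, f w = ∫ w in {w : ℂ | t < ℓ w}, dbarAlong 1 ψ w * g w :=
      integral_congr_ae (Eventually.of_forall fun w => mul_comm _ _)
    have e2 : ∀ x : ℝ, ψ (A ((x : ℂ) + (t : ℂ) * I)) = (t : ℂ) * χ (A ((x : ℂ) + (t : ℂ) * I)) := by
      intro x
      show ((ℓ (A ((x : ℂ) + (t : ℂ) * I)) : ℝ) : ℂ) * χ (A ((x : ℂ) + (t : ℂ) * I)) = _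
      rw [hAlev]
      simp
    rw [e1, key]
    show -(n / 2) * ∫ x : ℝ, ψ (A ((x : ℂ) + (t : ℂ) * I)) * g (A ((x : ℂ) + (t : ℂ) * I)) =
      -(n / 2) * t * ∫ x : ℝ, χ (A ((x : ℂ) + (t : ℂ) * I)) * g (A ((x : ℂ) + (t : ℂ) * I))
    simp only [e2]
    rw [← integral_const_mul, ← integral_const_mul]
    refine integral_congr_ae (Eventually.of_forall fun x => ?_)
    ring
  ---------------------------------------------------------------- Step 3: the Fubini majorant
  set e : ℝ × ℝ → ℂ := fun p => A ((p.2 : ℂ) + (p.1 : ℂ) * I) with he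
  have hemp : MeasurePreserving e volume volume := by
    have h1 : MeasurePreserving (fun p : ℝ × ℝ => ((p.2 : ℂ) + (p.1 : ℂ) * I)) volume volume := by
      have ha : (fun p : ℝ × ℝ => ((p.2 : ℂ) + (p.1 : ℂ) * I)) =
          (measurableEquivRealProd.symm : ℝ × ℝ → ℂ) ∘ (Prod.swap : ℝ × ℝ → ℝ × ℝ) := by
        funext p
        simp only [Function.comp_apply, Prod.swap, measurableEquivRealProd_symm_apply, mk_eq_add_mul_I]
      rw [ha]
      have hsw : MeasurePreserving (Prod.swap : ℝ × ℝ → ℝ × ℝ) volume volume := by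
        rw [Measure.volume_eq_prod]; exact Measure.measurePreserving_swap
      exact (volume_preserving_equiv_real_prod.symm _).comp hsw
    exact (measurePreserving_frame z c hcn).comp h1
  have heme : MeasurableEmbedding e := by
    have h1 : MeasurableEmbedding (fun p : ℝ × ℝ => ((p.2 : ℂ) + (p.1 : ℂ) * I)) := by
      have ha : (fun p : ℝ × ℝ => ((p.2 : ℂ) + (p.1 : ℂ) * I)) =
          (measurableEquivRealProd.symm : ℝ × ℝ → ℂ) ∘ (MeasurableEquiv.prodComm : ℝ × ℝ → ℝ × ℝ) := by
        funext p
        simp only [Function.comp_apply, MeasurableEquiv.prodComm, MeasurableEquiv.coe_mk,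
          Equiv.prodComm_apply, Prod.swap, measurableEquivRealProd_symm_apply, mk_eq_add_mul_I]
      rw [ha]
      exact measurableEquivRealProd.symm.measurableEmbedding.comp MeasurableEquiv.prodComm.measurableEmbedding
    exact (measurableEmbedding_frame z c hcn).comp h1
  set S : Set ℂ := hp ∩ ball z (s / 2) with hS
  have hSm : MeasurableSet S := (hhpo.inter isOpen_ball).measurableSet
  have hSΩ : S ⊆ closedBall z (s / 2) ∩ Ω := fun w hw =>
    ⟨ball_subset_closedBall hw.2, (hΩhp w (ball_subset_ball (by linarith) hw.2)).2 hw.1⟩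
  have hgS : IntegrableOn g S := hgi.mono_set hSΩ
  set G : ℝ × ℝ → ℂ := fun p => S.indicator g (e p) with hG
  have hGi : Integrable G (volume.prod volume) := by
    have h1 : Integrable (S.indicator g) volume := hgS.integrable_indicator hSm
    have h2 := (hemp.integrable_comp_emb heme).2 h1
    rw [Measure.volume_eq_prod] at h2
    exact h2
  set m : ℝ → ℝ := fun t => ∫ x : ℝ, ‖G (t, x)‖ with hm
  have hmi : Integrable m volume := hGi.integral_norm_prod_left
  have hslice : ∀ᵐ t : ℝ, Integrable (fun x => G (t, x)) volume := hGi.prod_right_ae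
  -- the bound `‖I t‖ ≤ t/2 · M · m t` at every good level `t ∈ (0, s/2)`
  have hbound : ∀ t : ℝ, 0 < t → Integrable (fun x => G (t, x)) volume →
      ‖∫ w in {w : ℂ | t < ℓ w}, f w‖ ≤ t * ((M / 2) * m t) := by
    intro t ht hint
    rw [hI t ht]
    have e3 : ∀ x : ℝ, χ (A ((x : ℂ) + (t : ℂ) * I)) * g (A ((x : ℂ) + (t : ℂ) * I)) =
        χ (A ((x : ℂ) + (t : ℂ) * I)) * G (t, x) := by
      intro x
      have hex : e (t, x) = A ((x : ℂ) + (t : ℂ) * I) := rfl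
      by_cases hx : A ((x : ℂ) + (t : ℂ) * I) ∈ S
      · simp only [hG, hex, indicator_of_mem hx]
      · have hnb : A ((x : ℂ) + (t : ℂ) * I) ∉ ball z (s / 2) := fun h =>
          hx ⟨by show 0 < ℓ (A _); rw [hAlev]; simpa using ht, h⟩
        rw [image_eq_zero_of_notMem_tsupport (fun h => hnb (hχs h)), zero_mul, zero_mul]
    have e4 : ‖-(n / 2) * (t : ℂ)‖ = t / 2 := by
      rw [norm_mul, norm_neg, norm_div, hn, Complex.norm_real, Real.norm_of_nonneg ht.le]
      norm_num
      ring
    calc ‖-(n / 2) * (t : ℂ) * ∫ x : ℝ, χ (A ((x : ℂ) + (t : ℂ) * I)) * g (A ((x : ℂ) + (t : ℂ) * I))‖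
        = t / 2 * ‖∫ x : ℝ, χ (A ((x : ℂ) + (t : ℂ) * I)) * G (t, x)‖ := by
          rw [norm_mul, e4]
          simp only [e3]
      _ ≤ t / 2 * ∫ x : ℝ, M * ‖G (t, x)‖ := by
          gcongr
          refine norm_integral_le_of_norm_le (hint.norm.const_mul M) (Eventually.of_forall fun x => ?_)
          rw [norm_mul]
          gcongr
          exact hM' _
      _ = t * ((M / 2) * m t) := by rw [integral_const_mul]; ring
  ---------------------------------------------------------------- Step 4: levels `t_j ↓ 0`
  have hchoose : ∀ j : ℕ, ∃ t : ℝ, 0 < t ∧ t < min (s / 2) (1 / ((j : ℝ) + 1)) ∧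
      ‖∫ w in {w : ℂ | t < ℓ w}, f w‖ ≤ 1 / ((j : ℝ) + 1) := by
    intro j
    have hε : 0 < min (s / 2) (1 / ((j : ℝ) + 1)) := lt_min (by linarith) (by positivity)
    refine exists_small_of_integrable_majorant (m := fun t => (M / 2 + 1) * m t) hε (by positivity)
      ((hmi.const_mul _).integrableOn) ?_
    rw [ae_restrict_iff' measurableSet_Ioo]
    filter_upwards [hslice] with t hint ht
    have hmt : 0 ≤ m t := integral_nonneg fun x => norm_nonneg _
    calc ‖∫ w in {w : ℂ | t < ℓ w}, f w‖ ≤ t * ((M / 2) * m t) := hbound t ht.1 hint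
      _ ≤ t * ((M / 2 + 1) * m t) :=
          mul_le_mul_of_nonneg_left (mul_le_mul_of_nonneg_right (by linarith) hmt) ht.1.le
  choose tseq htseq using hchoose
  have ht0 : Tendsto tseq atTop (𝓝 0) := by
    refine tendsto_of_tendsto_of_tendsto_of_le_of_le tendsto_const_nhds
      tendsto_one_div_add_atTop_nhds_zero_nat (fun j => (htseq j).1.le) fun j => ?_
    exact ((htseq j).2.1.trans_le (min_le_right _ _)).le
  ---------------------------------------------------------------- Step 5: dominated convergence
  have hfi : Integrable (hp.indicator f) volume := by
    have h1 : IntegrableOn f (hp ∩ closedBall z (s / 2)) := by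
      have hsub : hp ∩ closedBall z (s / 2) ⊆ closedBall z (s / 2) ∩ Ω := fun w hw =>
        ⟨hw.2, (hΩhp w (closedBall_subset_ball (by linarith) hw.2)).2 hw.1⟩
      have h := (hgi.mono_set hsub).bdd_mul (continuous_dbarAlong_one hψ1).aestronglyMeasurable
        (Eventually.of_forall hB')
      exact h.congr (Eventually.of_forall fun w => mul_comm _ _)
    have h2 : IntegrableOn f hp :=
      h1.of_forall_sdiff_eq_zero hhpo.measurableSet fun w hw =>
        hf0 w fun h => hw.2 ⟨hw.1, ball_subset_closedBall h⟩
    exact h2.integrable_indicator hhpo.measurableSet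
  set F : ℕ → ℂ → ℂ := fun j => {w : ℂ | tseq j < ℓ w}.indicator (hp.indicator f) with hF
  have hlev : ∀ j, MeasurableSet {w : ℂ | tseq j < ℓ w} := fun j =>
    (isOpen_lt continuous_const hℓc).measurableSet
  have hFm : ∀ j, AEStronglyMeasurable (F j) volume := fun j =>
    hfi.aestronglyMeasurable.indicator (hlev j)
  have hFle : ∀ j, ∀ᵐ w ∂volume, ‖F j w‖ ≤ ‖hp.indicator f w‖ := fun j =>
    Eventually.of_forall fun w => norm_indicator_le_norm_self _ _
  have hFlim : ∀ᵐ w ∂volume, Tendsto (fun j => F j w) atTop (𝓝 (hp.indicator f w)) := by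
    refine Eventually.of_forall fun w => ?_
    by_cases hw : 0 < ℓ w
    · have hev : ∀ᶠ j in atTop, hp.indicator f w = F j w := by
        filter_upwards [ht0.eventually (gt_mem_nhds hw)] with j hj
        simp only [hF]
        rw [indicator_of_mem (show w ∈ {w : ℂ | tseq j < ℓ w} from hj)]
      exact tendsto_const_nhds.congr' hev
    · have h0 : hp.indicator f w = 0 := indicator_of_notMem (show w ∉ hp from hw) _
      have hF0 : ∀ j, F j w = 0 := fun j => by
        simp only [hF]
        by_cases hj : w ∈ {w : ℂ | tseq j < ℓ w}
        · rw [indicator_of_mem hj, h0]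
        · rw [indicator_of_notMem hj]
      simp only [hF0, h0]
      exact tendsto_const_nhds
  have hDC := tendsto_integral_of_dominated_convergence (fun w => ‖hp.indicator f w‖) hFm hfi.norm hFle hFlim
  have hFint : ∀ j, ∫ w, F j w = ∫ w in {w : ℂ | tseq j < ℓ w}, f w := fun j => by
    simp only [hF]
    rw [integral_indicator (hlev j)]
    refine setIntegral_congr_fun (hlev j) fun w hw => ?_
    exact indicator_of_mem (show w ∈ hp from lt_trans (htseq j).1 hw) f
  have hlim0 : Tendsto (fun j => ∫ w, F j w) atTop (𝓝 0) := by
    rw [tendsto_zero_iff_norm_tendsto_zero]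
    refine squeeze_zero (fun j => norm_nonneg _) (fun j => ?_) tendsto_one_div_add_atTop_nhds_zero_nat
    rw [hFint]
    exact (htseq j).2.2
  have heq := tendsto_nhds_unique hDC hlim0
  rw [integral_indicator hhpo.measurableSet] at heq
  show ∫ w in Ω, f w = 0
  rw [step1, heq]

end Summit.CriticalPhenomena.SAWScalingLimit.Theorems.PolygonParitySqueeze.PolygonLocal

end
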